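import Summits.QuantumFields.YangMills.Theorems.BalabanUVNodesN09AxialCovariance181

/-!
# NODE N09 — THE AXIAL CONVENTION OF [I] (2.3) IS SATISFIABLE BY RE-SELECTION: a selection of minimisers of (0.21) with the record's contract whose critical
# configurations `M^k(U_{k+1}(W))` are in the block axial gauge EXISTS (every `ContourData`), and it is block-lift covariant wherever the minimal orbit is unique
# — the non-vacuity (A6) companion of the `haxD` ∕ `haxDom` binders of FILES 5–7

TRACK A (YM-PLAN §2d, node N09 of 28), seat `pub-ymgap-dag-n09-w2` (D-0149 width seat 2∕4), generation g2, FILE 8.  Key of record: K1⁷ `StabilityBAtRecordR13SepCoPH` =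
stmt-QuantumFields-20542; `--supports` it as a helper (Summits lane).  [I] = [Balaban1987RG1] (CMP 109), [B11] = [Balaban1985Variational] (CMP 102), [B8] =
[Balaban1985RegularSpaces] (CMP 99).

WHY.  FILES 5–7 (`…N09AxialCovariance181`, `…OnDomains`, `…OnDomainsReg8`) reduce the selection side of N09's Theorem-3 member to ONE displayed binder, [I] (2.3)'s convention
«`V^{(k)}(W) = M^k(U_{k+1}(W))` with `U_{k+1}(W)` in the axial gauge»: `haxDom : ∀ W ∈ domAlt_{j+1}, AxialGauge (cd j) (critCfgOfRecord θ.ν P.K j W)`.  For the record's bare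
choice `Uk` it can be neither proved nor refuted (an opaque `Classical.choose`).  THIS FILE shows it is SATISFIABLE by a selection with the SAME contract — lineage rule A6 for the
binder, and the existence half of the OFFER priced in FILE 5 (the one-token re-point `Uk := sel`): for every contour system, every minimiser `U₀` over `W` has a residual-gauge
image `U₀^w` (`w = 1` on `T^{(k+1)}`, so `U₀^w` is again a minimiser over `W`, dag-p07 `isBackground_gaugeAct`) whose `k`-fold average is block-axial — take `w := ū` the
block-constant lift (r15 `blockLift k u`) of FILE 5's fine axial-gauging element `u` of `M^k(U₀)` ([B8] (1.15): the lift is residual one level up, `blockIter_embIter`, and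
`M^k(U₀^{ū}) = (M^k U₀)^u`, r13 `iter_gaugeAct` + `toMS_blockLift_self`).
* §1 (generic `G`) `isResidual_blockLift_of_fine`, `iter_gaugeAct_blockLift`, ★ `exists_residual_iter_axial` (every configuration of `T_η` has a residual image with
  block-axial `k`-fold average), `exists_isBackground_orbitRel_iter_axial` (… hence every minimiser has an axial-averaged minimiser in its residual orbit),
  ★ `exists_axialSelection` (for ANY selection `sel₀` of minimisers on a set `S`: a selection `sel` with `sel W` in the residual orbit of `sel₀ W`, minimising wherever
  `sel₀` does, same Wilson action, and `M^k(sel W)` axial for EVERY `W`), `axialSelection_covariant` (such `sel` is block-lift covariant at every `W ∈ S` with `W^v ∈ S` and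
  unique minimal orbit — FILE 5 `iter_sel_gaugeAct_of_axial`).
* §2 (record, `SU(N)`, `avOfRecord`, `bgReg`, radius `ν.εreg`) ★★ `exists_axial_repoint_of_Uk` — per torus `K` and level `k` (`k + 1 ≤ m + K`) and contour system `cd`:
  a map `sel` with `IsBackground … W (sel W)` on the solvable set (= `isBackground_Uk`'s contract), `OrbitRel (k+1) (Uk … W) (sel W)` and `A(sel W) = A(Uk … W)` for EVERY
  `W` (so `wilsonBGOfRecord` is unchanged by the re-point and `sel W = 1`-orbit off the solvable set), `AxialGauge cd (M^k (sel W))` for EVERY `W` (`haxD`∕`haxDom` with NO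
  domain restriction), and `M^k(sel (W^v)) = (M^k(sel W))^{v∘blockOf}` whenever `UkExists … W ∧ UniqueUkOrbit … W` (`hcov` on the [B11] domain).
LOCATED (not settled here): adopting such a `sel` for `Uk` (or `ax ∘ critCfgOfRecord`) is a RECORD EDITION (node00-def-B ∕ K0e ∕ def-T); measurability of a concrete `sel`
(the (H-U) species) is dag-n09-w4's lane (`UkSel`, rooted gauge at level 0) — the present `sel` is obtained by choice and no measurability is claimed.

HONEST FRAMING: kernel gauge algebra over NODE 00's definitions of record; NOTHING of Bałaban's asserted ([B11] Thm 1's clauses are hypotheses where they appear); NO carrier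
re-pointed; N09 NOT discharged; K0⁷ ∕ K1⁷ OPEN; counts unmoved (typed 28∕28 · discharged 5∕27); R4 is the conditional finite-𝕋⁴ rung `BalabanLadder.UV` only — NOT continuum ∕
ℝ⁴ ∕ OS ∕ mass gap ∕ Clay.  THEOREMS ONLY (0 `def`, 0 `sorry`), standard axioms.
-/

noncomputable section

namespace Summit.QuantumFields.YangMills.BalabanUVNodes.N09AxialSelectionExists

open Literature.MathematicalPhysics.QuantumFieldTheory.Balaban1983to89
open Literature.MathematicalPhysics.QuantumFieldTheory.Balaban1983to89.Node00
open B12RTGaugeInvariance254 (liftTransf)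
open B12GaugeOrbits021 (IsResidual OrbitRel isBackground_gaugeAct wilsonAction4_eq_of_orbitRel)
open B16Sect1Backgrounds (toMS iter_gaugeAct)
open B15Eq177GaugeInvariance (blockLift toMS_blockLift_self)
open B15DeterminingSets (embIter)
open GaugeField (gaugeAct)
open Summit.QuantumFields.YangMills.BalabanUVNodes.N09LiftInvariance29AtRecord (gaugeAct_mem_bgReg ukExists_gaugeAct_iff)
open Summit.QuantumFields.YangMills.BalabanUVNodes.N09AxialCovariance181 (exists_fine_axialGauge iter_sel_gaugeAct_of_axial uniqueUkOrbit_gaugeAct_iff)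

/-! ## §1. Generic gauge group: every residual orbit contains a configuration with block-axial `k`-fold average -/

section Generic

variable {P : Params} {G : Type*} [GaugeGroup G] {k : ℕ}

/-- The block-constant lift `ū = u ∘ B^k` of a level-`k` transformation that is FINE (`u = 1` at the centres `emb y`, `y ∈ T^{(k+1)}`) is RESIDUAL of level `k+1` on `T_η`
(`ū(ι_{k+1} y) = u(B^k(ι_k(emb y))) = u(emb y) = 1`, r15 `blockIter_embIter`; `k ≤ m + K`). [cite: Balaban1985RegularSpaces, (1.14)–(1.15) p.78; Balaban1985Variational, (4) p.278] -/
theorem isResidual_blockLift_of_fine (hk : k ≤ P.m + P.K) {u : GaugeTransf P k G} (hu : ∀ y : Site P (k + 1), u (emb y) = 1) :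
    IsResidual (k + 1) (blockLift k u) := by
  intro y
  have h := congrFun (toMS_blockLift_self hk u) (emb y)
  -- `h : toMS (blockLift k u) k (emb y) = u (emb y)`, and `embIter (k+1) y = embIter k (emb y)` definitionally
  show blockLift k u (embIter k (emb y)) = 1
  rw [← hu y]
  exact h

/-- `M^k(U^{ū}) = (M^k U)^u` for the block-constant lift `ū` of a level-`k` transformation `u` (r13 `iter_gaugeAct` + r15 `toMS_blockLift_self`; `k ≤ m + K`).
[cite: Balaban1985Averaging, (11) p.19; Balaban1985Variational, (181) p.307] -/
theorem iter_gaugeAct_blockLift (av : ∀ i, Averaging P i G) (hk : k ≤ P.m + P.K) (u : GaugeTransf P k G) (U : GaugeField P 0 G) :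
    Averaging.iter av k (gaugeAct (blockLift k u) U) = gaugeAct u (Averaging.iter av k U) := by
  rw [iter_gaugeAct av (blockLift k u) U k hk, toMS_blockLift_self hk]

/-- ★ **EVERY RESIDUAL ORBIT OF LEVEL `k+1` MEETS «`M^k` BLOCK-AXIAL»**: for every configuration `U` of `T_η` and every contour system `cd` of `T^{(k)}` there is a residual `w`
(`w = 1` on `T^{(k+1)}`) with `M^k(U^w)` in the block axial gauge — `w := ū` for FILE 5's fine axial-gauging element `u` of `M^k(U)` (`exists_fine_axialGauge`).  Standing range
`k + 1 ≤ m + K`. [cite: Balaban1987RG1, (2.3) p.265; Balaban1985RegularSpaces, (1.15) p.78] -/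
theorem exists_residual_iter_axial (av : ∀ i, Averaging P i G) (hk : k + 1 ≤ P.m + P.K) (cd : ContourData P k G) (U : GaugeField P 0 G) :
    ∃ w : GaugeTransf P 0 G, IsResidual (k + 1) w ∧ AxialGauge cd (Averaging.iter av k (gaugeAct w U)) := by
  obtain ⟨u, hu, hax⟩ := exists_fine_axialGauge hk cd (Averaging.iter av k U)
  refine ⟨blockLift k u, isResidual_blockLift_of_fine (Nat.le_of_succ_le hk) hu, ?_⟩
  rw [iter_gaugeAct_blockLift av (Nat.le_of_succ_le hk) u U]
  exact hax

/-- **… HENCE EVERY MINIMISER OF (0.21) HAS AN AXIAL-AVERAGED MINIMISER IN ITS RESIDUAL ORBIT** (class `reg` stable under all gauge transformations; dag-p07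
`isBackground_gaugeAct`: a residual image of a minimiser is a minimiser; same Wilson action). [cite: Balaban1987RG1, (0.21) p.256 and (2.3) p.265; Balaban1985Variational, Thm 1 p.279] -/
theorem exists_isBackground_orbitRel_iter_axial {av : ∀ i, Averaging P i G} {reg : Set (GaugeField P 0 G)} (hk : k + 1 ≤ P.m + P.K)
    (hreg : ∀ (u : GaugeTransf P 0 G) (U : GaugeField P 0 G), U ∈ reg → gaugeAct u U ∈ reg) (cd : ContourData P k G)
    {W : GaugeField P (k + 1) G} {U₀ : GaugeField P 0 G} (h : IsBackground av reg (k + 1) W U₀) :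
    ∃ U₁ : GaugeField P 0 G, IsBackground av reg (k + 1) W U₁ ∧ OrbitRel (k + 1) U₀ U₁ ∧ AxialGauge cd (Averaging.iter av k U₁) := by
  obtain ⟨w, hw, hax⟩ := exists_residual_iter_axial av hk cd U₀
  exact ⟨gaugeAct w U₀, isBackground_gaugeAct hk (fun u _ U hU => hreg u U hU) h hw, ⟨w, hw, rfl⟩, hax⟩

/-- ★ **AN AXIAL RE-SELECTION EXISTS FOR EVERY SELECTION**: for any map `sel₀` from coarse fields to configurations of `T_η` there is a map `sel` with, for EVERY `W`:
`sel W` in the residual orbit of `sel₀ W` (so `A(sel W) = A(sel₀ W)`, and `sel W` minimises (0.21) over `W` whenever `sel₀ W` does), and `M^k(sel W)` in the block axial gauge of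
`cd`.  (Choice over `exists_residual_iter_axial`; no measurability claimed.) [cite: Balaban1987RG1, (2.3) p.265; Balaban1985RegularSpaces, (1.15) p.78] -/
theorem exists_axialSelection {av : ∀ i, Averaging P i G} {reg : Set (GaugeField P 0 G)} (hk : k + 1 ≤ P.m + P.K)
    (hreg : ∀ (u : GaugeTransf P 0 G) (U : GaugeField P 0 G), U ∈ reg → gaugeAct u U ∈ reg) (cd : ContourData P k G)
    (sel₀ : GaugeField P (k + 1) G → GaugeField P 0 G) :
    ∃ sel : GaugeField P (k + 1) G → GaugeField P 0 G,
      (∀ W, OrbitRel (k + 1) (sel₀ W) (sel W)) ∧ (∀ W, wilsonAction4 (sel W) = wilsonAction4 (sel₀ W)) ∧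
      (∀ W, IsBackground av reg (k + 1) W (sel₀ W) → IsBackground av reg (k + 1) W (sel W)) ∧ ∀ W, AxialGauge cd (Averaging.iter av k (sel W)) := by
  choose w hw hax using fun U => exists_residual_iter_axial av hk cd U
  refine ⟨fun W => gaugeAct (w (sel₀ W)) (sel₀ W), fun W => ⟨w (sel₀ W), hw _, rfl⟩, fun W => wilsonAction4_eq_of_orbitRel ⟨w (sel₀ W), hw _, rfl⟩,
    fun W h => isBackground_gaugeAct hk (fun u _ U hU => hreg u U hU) h (hw _), fun W => hax _⟩

/-- **AN AXIAL SELECTION OF MINIMISERS IS BLOCK-LIFT COVARIANT WHERE THE MINIMAL ORBIT IS UNIQUE** (FILE 5 `iter_sel_gaugeAct_of_axial`): `M^k(sel (W^v)) = (M^k(sel W))^{v∘blockOf}`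
at every `W` such that `sel` minimises over `W` and `W^v` and the minimal orbit over `W^v` is unique under the residual group ([B11] Thm 1).
[cite: Balaban1987RG1, (2.3) p.265; Balaban1985Variational, Thm 1 p.279 and (181) p.307] -/
theorem axialSelection_covariant {av : ∀ i, Averaging P i G} {reg : Set (GaugeField P 0 G)} (hk : k + 1 ≤ P.m + P.K)
    (hreg : ∀ (u : GaugeTransf P 0 G) (U : GaugeField P 0 G), U ∈ reg → gaugeAct u U ∈ reg) (cd : ContourData P k G)
    {sel : GaugeField P (k + 1) G → GaugeField P 0 G} (hax : ∀ W, AxialGauge cd (Averaging.iter av k (sel W)))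
    {W : GaugeField P (k + 1) G} {v : GaugeTransf P (k + 1) G}
    (hW : IsBackground av reg (k + 1) W (sel W)) (hvW : IsBackground av reg (k + 1) (gaugeAct v W) (sel (gaugeAct v W)))
    (huniq : ∀ U₀ U₀' : GaugeField P 0 G, IsBackground av reg (k + 1) (gaugeAct v W) U₀ → IsBackground av reg (k + 1) (gaugeAct v W) U₀' →
      OrbitRel (k + 1) U₀ U₀') :
    Averaging.iter av k (sel (gaugeAct v W)) = gaugeAct (liftTransf v) (Averaging.iter av k (sel W)) :=
  iter_sel_gaugeAct_of_axial hk hreg cd hW hvW huniq (hax W) (hax _)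

end Generic

/-! ## §2. The record: a re-point of `U_{k+1}` with the same contract, block-axial critical configurations and (181)ˢᵒˡ covariance EXISTS -/

variable {F : T4Continuum.T4Family} {N : ℕ} [NeZero N]

/-- ★★ **THE AXIAL CONVENTION (2.3) IS SATISFIABLE AT THE RECORD WITH `Uk`'s CONTRACT** (torus `K`, level `k` with `k + 1 ≤ m + K`, radius `ε`, ANY contour system `cd` of
`T^{(k)}` — e.g. def-B's `contourOfRecord F N K k`): there is a map `sel` on the level-`(k+1)` fields with — (i) `sel W` in the residual orbit of the bare choice `Uk … W` and
`A(sel W) = A(Uk … W)` for EVERY `W` (so the (0.22) value `wilsonBGOfRecord` and the junk corner's orbit are unchanged); (ii) `IsBackground … W (sel W)` on the solvable set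
(`isBackground_Uk`'s contract); (iii) `M^k(sel W)` BLOCK-AXIAL for EVERY `W` (the binder `haxD`∕`haxDom` of FILES 5–7 for the re-pointed critical configuration, with no domain
restriction); (iv) `M^k(sel (W^v)) = (M^k(sel W))^{v∘blockOf}` whenever `UkExists … W ∧ UniqueUkOrbit … W` — the (181)ˢᵒˡ covariance `hcov` on the [B11] domain, from
uniqueness alone.  Existence by choice; measurability NOT claimed (dag-n09-w4's lane). [cite: Balaban1987RG1, (0.21)–(0.22) p.256 and (2.3) p.265; Balaban1985Variational, Thm 1 p.279 and (181) p.307] -/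
theorem exists_axial_repoint_of_Uk {K k : ℕ} (hk : k + 1 ≤ (F.P K).m + (F.P K).K) (ε : ℝ) (cd : ContourData (F.P K) k (SU N)) :
    ∃ sel : GaugeField (F.P K) (k + 1) (SU N) → GaugeField (F.P K) 0 (SU N),
      (∀ W, OrbitRel (k + 1) (Uk F N K (k + 1) ε W) (sel W)) ∧
      (∀ W, wilsonAction4 (sel W) = wilsonAction4 (Uk F N K (k + 1) ε W)) ∧
      (∀ W, UkExists F N K (k + 1) ε W → IsBackground (avOfRecord F N K) (bgReg F N K (k + 1) ε) (k + 1) W (sel W)) ∧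
      (∀ W, AxialGauge cd (Averaging.iter (avOfRecord F N K) k (sel W))) ∧
      ∀ (v : GaugeTransf (F.P K) (k + 1) (SU N)) (W : GaugeField (F.P K) (k + 1) (SU N)),
        UkExists F N K (k + 1) ε W → UniqueUkOrbit F N K (k + 1) ε W →
          Averaging.iter (avOfRecord F N K) k (sel (gaugeAct v W)) = gaugeAct (liftTransf v) (Averaging.iter (avOfRecord F N K) k (sel W)) := by
  obtain ⟨sel, horb, hA, hbg, hax⟩ := exists_axialSelection (av := avOfRecord F N K) (reg := bgReg F N K (k + 1) ε) hk
    (fun u U hU => gaugeAct_mem_bgReg u U hU) cd (Uk F N K (k + 1) ε)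
  refine ⟨sel, horb, hA, fun W hW => hbg W (isBackground_Uk hW), hax, fun v W hW huW => ?_⟩
  exact axialSelection_covariant hk (fun u U hU => gaugeAct_mem_bgReg u U hU) cd hax (hbg W (isBackground_Uk hW))
    (hbg _ (isBackground_Uk ((ukExists_gaugeAct_iff hk ε v W).2 hW))) ((uniqueUkOrbit_gaugeAct_iff hk ε v W).2 huW)

/-- **THE BINDERS `hsolv`-STYLE CONTRACT AND `haxDom` ARE JOINTLY SATISFIABLE ON ANY SET OF SOLVABLE FIELDS** — the A6 reading for FILES 5–7: for `S` inside the solvable set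
there is a selection minimising on `S` with block-axial `k`-fold averages on `S` (indeed everywhere). [cite: Balaban1987RG1, (2.3) p.265; Balaban1985Variational, Thm 1 p.279] -/
theorem exists_selection_isBackground_and_axialOn {K k : ℕ} (hk : k + 1 ≤ (F.P K).m + (F.P K).K) (ε : ℝ) (cd : ContourData (F.P K) k (SU N))
    {S : Set (GaugeField (F.P K) (k + 1) (SU N))} (hS : ∀ W ∈ S, UkExists F N K (k + 1) ε W) :
    ∃ sel : GaugeField (F.P K) (k + 1) (SU N) → GaugeField (F.P K) 0 (SU N),
      (∀ W ∈ S, IsBackground (avOfRecord F N K) (bgReg F N K (k + 1) ε) (k + 1) W (sel W)) ∧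
      ∀ W ∈ S, AxialGauge cd (Averaging.iter (avOfRecord F N K) k (sel W)) := by
  obtain ⟨sel, -, -, hbg, hax, -⟩ := exists_axial_repoint_of_Uk (F := F) (N := N) hk ε cd
  exact ⟨sel, fun W hW => hbg W (hS W hW), fun W _ => hax W⟩

end Summit.QuantumFields.YangMills.BalabanUVNodes.N09AxialSelectionExists
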